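import Literature.MathematicalPhysics.QuantumFieldTheory.Balaban1983to89.B8Eq191FlatDirichletDepth

/-!
# `Balaban1983to89.B8Eq191FlatDirichletLateral` — [Balaban1984PropagatorsII] (2.46) p. 231 ∕ Lemma 2.1 (2.60)–(2.61) p. 234 ON THE CUBE MEMBER `{□_j}` of [Balaban1985RegularSpaces]
# (1.131): EXCURSION COST and LATERAL CONFINEMENT of the tower-scaled site distance — a site at scaled distance `< R` from `x` lies within `R·L^{jₓ+1+⌊R∕ρ⌋}` of `x` in every
# coordinate (brick 4c, part 1, of the (R1′) programme of DAG node N05: the geometric input of the counting lemma)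

statement-level skeleton of published theorems with citation tags; proofs where landed; nothing here is a claim about the
Yang–Mills mass gap

T. Bałaban, *Propagators and renormalization transformations for lattice gauge theories. II*, Commun. Math. Phys. **96** (1984) 223–250 `[Balaban1984PropagatorsII]` ("B6"):
(2.2) p. 224, (2.46) p. 231, Lemma 2.1 (2.60)–(2.61) p. 234 («sup_{y∈𝔅} Σ_{y′∈𝔅} e^{−αδ₀d(y,y′)} ≤ c₁(α)»); T. Bałaban, *Spaces of regular gauge field configurations …*,
Commun. Math. Phys. **99** (1985) 75–102 `[Balaban1985RegularSpaces]` ("B8"): p. 98, (1.131) p. 99.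

CITATION HEADER (lean-in-tree rule).  Cell `pub-ymgap` (YM Track A, HUMAN RULING D-0062), DAG node N05 = [B8], seat `pub-ymgap-dag-n05-c` (g8), programme (R1′) (memo
`R1PRIME-PROGRAMME.md`, seat HOME).  Bricks 4a∕4b (`B8Eq191FlatDirichletDistance ∕ Depth`) give the tower-scaled site distance `d_σ` and its DEPTH growth
`d_σ(x,z) ≥ ρ(|jₓ − j_z| − 1)`.  THIS FILE starts brick 4c — the LATERAL geometry of `d_σ`-balls, which is where the margin threshold of bus «LOCATED-ρ» comes from: inside one
collar, two far-apart sites are joined most cheaply THROUGH the coarser interior, so the distance-`R` ball reaches laterally as far as `R·L^{jₓ+1+R∕ρ}` — exponential in `R∕ρ`.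
The counting lemma itself (summing `e^{−2δ′d_σ}` against these balls, convergent iff `4δ′ρ ≳ d·ln L`) is brick 4c part 2.

WHAT THIS FILE PROVES (theorems only; 0 `def`).
* §1 `abs_sub_le_one_of_adj` (a bond moves each coordinate by ≤ 1), ★ `mul_abs_sub_le_walkCost` (a walk all of whose sites have scale `σ ≥ c ≥ 0` costs `≥ c·|x_ν − z_ν|`).
* §2 `support_subset` (walks from a site of `S` stay in `S`), `walkCost_takeUntil_le` (prefix monotonicity via `Walk.take_spec`), ★★ `walkCost_ge_excursion` (a walk in `□₀` from
  tower level `jₓ` visiting tower level `j_v` costs `≥ ρ(|jₓ − j_v| − 1)` — brick 4b's depth potential along the prefix).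
* §3 ★★★ **`lateral_le_of_lsDist_lt`** (LATERAL CONFINEMENT): `d_σ(x,z) < R ⇒ |x_ν − z_ν| ≤ R·L^{jₓ + 1 + ⌊R∕ρ⌋}` for every coordinate `ν` (a walk of cost `< R` exists by
  `ciInf_lt_iff` and `reachable_cubeMember`; by §2 it never exceeds tower level `jₓ + 1 + ⌊R∕ρ⌋`; by §1 its lateral displacement is `≤ R·L^{that level}`).

HONEST SCOPE.  Lattice geometry only; NO analytic estimate; not the counting lemma, not (1.101).  Count-neutral; N05 NOT discharged; one finite `T⁴` programme at fixed `ε`,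
Bałaban as printed; nothing continuum ∕ ℝ⁴ ∕ OS ∕ mass-gap ∕ Clay.  No `sorry`, no `def`, no `instance`, no `notation`.  Unit `pub-ymgap-dag-n05-c` (g8), 2026-08-27.

RELATED IN THE TREE, NOT DUPLICATED: `B6Geom246MultiLevelBox ∕ …Torus` + `B6Ineq261LevelGap` (p21: (2.46) and Lemma 2.1's counting `K261`, `theta_lt_one_of_log` on the Neumann-box ∕
torus BLOCK carriers — the model for brick 4c part 2; other carriers), `B6Cover236MultiLevelTorusReach*` (reachability on the torus block cover).
-/

noncomputable section

namespace Literature.MathematicalPhysics.QuantumFieldTheory.Balaban1983to89.B8Eq191FlatDirichletLateral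

open Finset
open B7Prop1Explicit (e)
open Literature.MathematicalPhysics.QuantumLattice (blockMap)
open B8Eq191FlatDirichletDistance (nnGraph walkCost lsDist walkCost_nil walkCost_cons walkCost_nonneg)

variable {d : ℕ} (S : Finset (Fin d → ℤ)) {σ : (Fin d → ℤ) → ℝ}

/-! ## §1 A walk whose sites all have scale `≥ c` costs at least `c` per unit of coordinate displacement -/

/-- A bond of the region graph moves each coordinate by at most one. [cite: Balaban1984PropagatorsII, (2.46) p.231] -/
theorem abs_sub_le_one_of_adj {x z : Fin d → ℤ} (h : (nnGraph S).Adj x z) (ν : Fin d) : |x ν - z ν| ≤ 1 := by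
  obtain ⟨-, -, -, μ, hμ⟩ := h
  rcases hμ with h | h
  · rw [h]; simp only [Pi.add_apply, e]
    by_cases hν : ν = μ
    · subst hν; simp
    · simp [Pi.single_eq_of_ne hν]
  · rw [h]; simp only [Pi.add_apply, e]
    by_cases hν : ν = μ
    · subst hν; simp
    · simp [Pi.single_eq_of_ne hν]

/-- **LATERAL COST OF A SHALLOW WALK**: if every site of a walk has scale `σ ≥ c ≥ 0`, the walk costs at least `c·|x_ν − z_ν|` in every coordinate direction `ν`
(each bond costs `≥ c` and moves the coordinate by `≤ 1`). [cite: Balaban1984PropagatorsII, (2.46) p.231, Lemma 2.1 (2.60) p.234] -/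
theorem mul_abs_sub_le_walkCost {c : ℝ} (hc : 0 ≤ c) (ν : Fin d) :
    ∀ {x z : Fin d → ℤ} (p : (nnGraph S).Walk x z), (∀ v ∈ p.support, c ≤ σ v) → c * |((x ν : ℤ) : ℝ) - ((z ν : ℤ) : ℝ)| ≤ walkCost S σ p := by
  intro x z p
  induction p with
  | nil => intro _; simp
  | @cons u v w h p ih =>
    intro hs
    rw [walkCost_cons]
    have hu : c ≤ σ u := hs u (SimpleGraph.Walk.start_mem_support _)
    have hv : c ≤ σ v := hs v (by simp)
    have hrest : ∀ y ∈ p.support, c ≤ σ y := fun y hy => hs y (by simp [hy])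
    have h1 : |((u ν : ℤ) : ℝ) - ((v ν : ℤ) : ℝ)| ≤ 1 := by exact_mod_cast abs_sub_le_one_of_adj S h ν
    have h2 := ih hrest
    calc c * |((u ν : ℤ) : ℝ) - ((w ν : ℤ) : ℝ)| ≤ c * (|((u ν : ℤ) : ℝ) - ((v ν : ℤ) : ℝ)| + |((v ν : ℤ) : ℝ) - ((w ν : ℤ) : ℝ)|) := by
          refine mul_le_mul_of_nonneg_left ?_ hc
          calc |((u ν : ℤ) : ℝ) - ((w ν : ℤ) : ℝ)| = |(((u ν : ℤ) : ℝ) - ((v ν : ℤ) : ℝ)) + (((v ν : ℤ) : ℝ) - ((w ν : ℤ) : ℝ))| := by ring_nf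
            _ ≤ _ := abs_add_le _ _
      _ = c * |((u ν : ℤ) : ℝ) - ((v ν : ℤ) : ℝ)| + c * |((v ν : ℤ) : ℝ) - ((w ν : ℤ) : ℝ)| := by ring
      _ ≤ min (σ u) (σ v) + walkCost S σ p := add_le_add ((mul_le_of_le_one_right hc h1).trans (le_min hu hv)) h2

/-! ## §2 Excursions: a walk that reaches tower level `j_v` from level `jₓ` costs at least `ρ·(|jₓ − j_v| − 1)` -/

open B8Eq131CubesAdmissible (cubeFam)
open B8CubeMemberZd (cubeLamS)
open B8Eq191FlatDirichletDistance (abs_sub_le_walkCost towerScale_eq)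
open B8Eq191FlatDirichletDepth (pot pot_testFunction pot_bounds reachable_cubeMember)
open B8Eq191FlatDirichletConjugation (cover_cubeMember)
open B8Eq191FlatLettersCubeMember (towers_disjoint_cube)

/-- The sites of a walk starting in `S` all lie in `S`. [folklore] [cite: Balaban1984PropagatorsII, (2.46) p.231] -/
theorem support_subset {x z : Fin d → ℤ} (p : (nnGraph S).Walk x z) (hx : x ∈ S) : ∀ v ∈ p.support, v ∈ S := by
  induction p with
  | nil => intro v hv; rw [SimpleGraph.Walk.support_nil, List.mem_singleton] at hv; rw [hv]; exact hx
  | cons h p ih =>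
    intro v hv
    rw [SimpleGraph.Walk.support_cons, List.mem_cons] at hv
    rcases hv with hv | hv
    · rw [hv]; exact hx
    · exact ih h.2.1 v hv

/-- Cost is monotone under taking a prefix: `cost(p.takeUntil v) ≤ cost(p)`. [cite: Balaban1984PropagatorsII, (2.46) p.231] -/
theorem walkCost_takeUntil_le (hσ : ∀ x, 0 ≤ σ x) {x z : Fin d → ℤ} (p : (nnGraph S).Walk x z) {v : Fin d → ℤ} (hv : v ∈ p.support) :
    walkCost S σ (p.takeUntil v hv) ≤ walkCost S σ p := by
  have h := congrArg (walkCost S σ) (p.take_spec hv)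
  rw [B8Eq191FlatDirichletDistance.walkCost_append] at h
  linarith [walkCost_nonneg S hσ (p.dropUntil v hv)]

open Classical in
/-- **EXCURSION COST ON THE CUBE MEMBER**: a walk in `□₀` from a site of tower level `jₓ` that visits a site of tower level `j_v` costs at least `ρ·(|jₓ − j_v| − 1)` in the
tower scale (the depth potential of brick 4b along the prefix). [cite: Balaban1984PropagatorsII, (2.2) p.224, (2.46) p.231, Lemma 2.1 (2.60) p.234; Balaban1985RegularSpaces, p.98] -/
theorem walkCost_ge_excursion (hd : 0 < d) {L : ℕ} (hL : 1 ≤ L) (a : Fin d → ℤ) (M : ℕ) {ρ : ℕ} (hρ : L ≤ ρ) {k n : ℕ} (hn : n ≤ k)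
    (hS : ∀ x, x ∈ S ↔ x ∈ cubeFam false L a M ρ k 0) {x z : Fin d → ℤ} (p : (nnGraph S).Walk x z)
    {v : Fin d → ℤ} (hv : v ∈ p.support) {jx jv : ℕ} (hjx : jx ≤ n) (hjv : jv ≤ n)
    (hxj : blockMap (L ^ jx) x ∈ cubeLamS L a M ρ k n jx) (hvj : blockMap (L ^ jv) v ∈ cubeLamS L a M ρ k n jv) :
    (ρ : ℝ) * (|(jx : ℝ) - jv| - 1)
      ≤ walkCost S (fun y => ∑ j' ∈ Finset.range (n + 1), (if blockMap (L ^ j') y ∈ cubeLamS L a M ρ k n j' then (((L : ℝ) ^ j'))⁻¹ else 0)) p := by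
  set σ' : (Fin d → ℤ) → ℝ := fun y => ∑ j' ∈ Finset.range (n + 1),
    (if blockMap (L ^ j') y ∈ cubeLamS L a M ρ k n j' then (((L : ℝ) ^ j'))⁻¹ else 0) with hσ'
  have hσ0 : ∀ y, 0 ≤ σ' y := fun y => B8Eq191FlatDirichletDistance.towerScale_nonneg L n (cubeLamS L a M ρ k n) y
  have hpre := abs_sub_le_walkCost S (σ := σ') (pot hd L a M ρ k n) (fun u w huw => pot_testFunction hd hL a M hρ hn S hS u w huw) (p.takeUntil v hv)
  have hmono := walkCost_takeUntil_le S hσ0 p hv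
  obtain ⟨hx1, hx2⟩ := pot_bounds hd hL a M hρ hn hjx hxj
  obtain ⟨hv1, hv2⟩ := pot_bounds hd hL a M hρ hn hjv hvj
  have hρ0 : (0 : ℝ) ≤ ρ := by positivity
  refine le_trans ?_ (hpre.trans hmono)
  rcases le_total (jx : ℝ) jv with h | h
  · calc (ρ : ℝ) * (|(jx : ℝ) - jv| - 1) = (ρ : ℝ) * jv - (ρ : ℝ) * jx - ρ := by rw [abs_of_nonpos (sub_nonpos.mpr h)]; ring
      _ ≤ pot hd L a M ρ k n v - pot hd L a M ρ k n x := by linarith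
      _ ≤ |pot hd L a M ρ k n x - pot hd L a M ρ k n v| := by rw [abs_sub_comm]; exact le_abs_self _
  · calc (ρ : ℝ) * (|(jx : ℝ) - jv| - 1) = (ρ : ℝ) * jx - (ρ : ℝ) * jv - ρ := by rw [abs_of_nonneg (sub_nonneg.mpr h)]; ring
      _ ≤ pot hd L a M ρ k n x - pot hd L a M ρ k n v := by linarith
      _ ≤ |pot hd L a M ρ k n x - pot hd L a M ρ k n v| := le_abs_self _

/-! ## §3 Lateral confinement: a site at scaled distance `< R` from `x` is within `R·L^{jₓ + 1 + ⌊R∕ρ⌋}` of `x` in every coordinate -/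

open Classical in
/-- **LATERAL CONFINEMENT** (the geometric input of the (2.61)-type counting on the cube member): if `d_σ(x, z) < R` for the tower scale `σ` then, for every coordinate `ν`,
`|x_ν − z_ν| ≤ R·L^{jₓ + 1 + ⌊R∕ρ⌋}` — a walk of cost `< R` never reaches tower level `> jₓ + 1 + R∕ρ` (excursion cost), so all its bonds cost `≥ L^{−(jₓ+1+⌊R∕ρ⌋)}` and it can
displace by at most `R·L^{jₓ+1+⌊R∕ρ⌋}`.  The lateral reach of the distance-`R` ball thus grows like `L^{R∕ρ}` — the source of the margin threshold of bus «LOCATED-ρ».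
[cite: Balaban1984PropagatorsII, (2.2) p.224, (2.46) p.231, Lemma 2.1 (2.60)–(2.61) p.234; Balaban1985RegularSpaces, p.98, (1.131) p.99] -/
theorem lateral_le_of_lsDist_lt (hd : 0 < d) {L : ℕ} (hL : 1 ≤ L) (a : Fin d → ℤ) (M : ℕ) {ρ : ℕ} (hρ : L ≤ ρ) {k n : ℕ} (hn : n ≤ k)
    (hS : ∀ x, x ∈ S ↔ x ∈ cubeFam false L a M ρ k 0) {x z : Fin d → ℤ} (hx : x ∈ S) (hz : z ∈ S)
    {jx : ℕ} (hjx : jx ≤ n) (hxj : blockMap (L ^ jx) x ∈ cubeLamS L a M ρ k n jx) {R : ℝ}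
    (hR : lsDist S (fun y => ∑ j' ∈ Finset.range (n + 1), (if blockMap (L ^ j') y ∈ cubeLamS L a M ρ k n j' then (((L : ℝ) ^ j'))⁻¹ else 0)) x z < R)
    (ν : Fin d) :
    |((x ν : ℤ) : ℝ) - ((z ν : ℤ) : ℝ)| ≤ R * (L : ℝ) ^ (jx + 1 + ⌊R / ρ⌋₊) := by
  set σ' : (Fin d → ℤ) → ℝ := fun y => ∑ j' ∈ Finset.range (n + 1),
    (if blockMap (L ^ j') y ∈ cubeLamS L a M ρ k n j' then (((L : ℝ) ^ j'))⁻¹ else 0) with hσ'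
  have hL0 : (0 : ℝ) < L := by exact_mod_cast hL
  have hρ1 : (1 : ℝ) ≤ ρ := by exact_mod_cast hL.trans hρ
  have hρ0 : (0 : ℝ) < ρ := by linarith
  have hdisj : ∀ y ∈ S, ∀ j, j ≤ n → ∀ j', j' ≤ n → blockMap (L ^ j) y ∈ cubeLamS L a M ρ k n j →
      blockMap (L ^ j') y ∈ cubeLamS L a M ρ k n j' → j = j' :=
    fun y hy j hj j' hj' h1 h2 => (towers_disjoint_cube hL a M hρ hn j hj j' hj' _ h1 _ h2 y ((hS y).mp hy) rfl rfl).1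
  -- a walk of cost `< R`
  haveI : Nonempty ((nnGraph S).Walk x z) := reachable_cubeMember a M ρ k S hS hx hz
  obtain ⟨p, hp⟩ := (ciInf_lt_iff ⟨0, fun r ⟨q, hq⟩ => hq ▸ walkCost_nonneg S
    (fun y => B8Eq191FlatDirichletDistance.towerScale_nonneg L n (cubeLamS L a M ρ k n) y) q⟩).mp hR
  -- every site of the walk has tower level `≤ jx + 1 + ⌊R/ρ⌋`, hence scale `≥ L^{-(jx+1+⌊R/ρ⌋)}`
  set J' : ℕ := jx + 1 + ⌊R / ρ⌋₊ with hJ'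
  have hscale : ∀ v ∈ p.support, (((L : ℝ) ^ J'))⁻¹ ≤ σ' v := by
    intro v hv
    have hvS : v ∈ S := support_subset S p hx v hv
    obtain ⟨jv, hjv, hvj⟩ := cover_cubeMember hL a M hρ hn v ((hS v).mp hvS)
    have hex := walkCost_ge_excursion S hd hL a M hρ hn hS p hv hjx hjv hxj hvj
    have hcost : (ρ : ℝ) * (|(jx : ℝ) - jv| - 1) < R := lt_of_le_of_lt hex hp
    -- `jv ≤ jx + 1 + ⌊R/ρ⌋`
    have hjv' : jv ≤ J' := by
      have h1 : (jv : ℝ) - jx - 1 < R / ρ := by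
        rw [lt_div_iff₀ hρ0]
        have : (jv : ℝ) - jx ≤ |(jx : ℝ) - jv| := by rw [abs_sub_comm]; exact le_abs_self _
        nlinarith
      have h2 : (jv : ℝ) < (jx : ℝ) + 1 + (⌊R / ρ⌋₊ : ℕ) + 1 := by
        have := Nat.lt_floor_add_one (R / ρ)
        linarith
      have h3 : jv < jx + 1 + ⌊R / ρ⌋₊ + 1 := by exact_mod_cast h2
      omega
    simp only [hσ']
    rw [towerScale_eq S L n (cubeLamS L a M ρ k n) hdisj hvS hjv hvj]
    exact inv_anti₀ (pow_pos hL0 _) (pow_le_pow_right₀ (by exact_mod_cast hL) hjv')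
  have hlat := mul_abs_sub_le_walkCost S (σ := σ') (c := (((L : ℝ) ^ J'))⁻¹) (by positivity) ν p hscale
  have hLJ : (0 : ℝ) < (L : ℝ) ^ J' := pow_pos hL0 _
  have : (((L : ℝ) ^ J'))⁻¹ * |((x ν : ℤ) : ℝ) - ((z ν : ℤ) : ℝ)| ≤ R := by linarith
  calc |((x ν : ℤ) : ℝ) - ((z ν : ℤ) : ℝ)| = ((L : ℝ) ^ J') * ((((L : ℝ) ^ J'))⁻¹ * |((x ν : ℤ) : ℝ) - ((z ν : ℤ) : ℝ)|) := by
        field_simp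
    _ ≤ ((L : ℝ) ^ J') * R := mul_le_mul_of_nonneg_left this hLJ.le
    _ = R * (L : ℝ) ^ J' := mul_comm _ _

end Literature.MathematicalPhysics.QuantumFieldTheory.Balaban1983to89.B8Eq191FlatDirichletLateral

end
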